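import Mathlib
import Literature.Topology.FourManifolds.AchiralLefschetzFibration
import Literature.AlgebraicTopology.SingularHomology.SingularChains

/-!
# Sketch — crux `SblfDescent.StepTwo` (stmt-SmoothPoincare4-18529), crux-ideate round 1, ideator 2

First lemmas of the two idea cards (they need not be proved here; they must elaborate).

* Card `montesinos-torus-surgery-rigidity`: `gcd_lemma` — the H₁-shadow of the lower-gluing
  defect: if some gluing direction `γ` in the fibre sublattice `c^⊥` completes
  `c, c₁, …, c₄` to a spanning set of `H₁(Σ₂) = ℤ⁴` (i.e. `H₁(X) = 0`), then the algebraic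
  intersection numbers `ω(cᵢ, c)` generate `ℤ` (algebraic MEETS for free, and the defect
  functional is primitive on the fibre lattice only through the Lefschetz cycles).
* Card `signature-pin-cable-push`: `NoTenNodalGenusTwo` — the pure-twist sector
  `μ = t_c^{-6}` of the signature pin `h_{2,c}(μ) = 12/5` is populated iff a genus-2 Lefschetz
  fibration over `S²` with exactly ten singular fibres, all irreducible, exists; the first
  checkable statement of that line is that it does not.
-/

namespace Summit.SmoothPoincare4.SmoothPoincare4.Cruxes.StepTwo.IdeateK2

open scoped Manifold ContDiff Topology

/-- The intersection pairing of `H₁(Σ₂; ℤ) = ℤ⁴` in a symplectic basis `a₁, b₁, a₂, b₂`. -/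
def omega (x y : Fin 4 → ℤ) : ℤ :=
  x 0 * y 1 - x 1 * y 0 + x 2 * y 3 - x 3 * y 2

/-- **First lemma of card `montesinos-torus-surgery-rigidity` (H₁-shadow of the defect
functional).**  `c` primitive (some `y` with `ω(y,c) = 1`), `γ` in the fibre lattice
(`ω(γ,c) = 0`), and `c, γ, c₁, …, c₄` spanning `ℤ⁴` (this is `H₁(X_γ) = 0` for the genus-2
SBLF with Hurwitz system `(c; c₁, …, c₄)` and lower gluing `γ`) force the ideal generated by the
`ω(cᵢ, c)` to be everything: some Lefschetz cycle crosses the round curve with total gcd one. -/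
theorem gcd_lemma : ∀ (c γ : Fin 4 → ℤ) (cs : Fin 4 → (Fin 4 → ℤ)),
    (∃ y, omega y c = 1) → omega γ c = 0 →
    Submodule.span ℤ ({c, γ} ∪ Set.range cs) = ⊤ →
    Ideal.span (Set.range fun i => omega (cs i) c) = ⊤ := by
  sorry

/-- **First lemma of card `signature-pin-cable-push` (the pure-twist sector is empty).**
No Lefschetz fibration of a closed connected oriented smooth 4-manifold over `S²` with regular
fibres connected of genus 2 (`H₁ ≅ ℤ⁴`) has exactly ten critical points all of whose singular
fibres are irreducible (irreducible ⟺ the singular fibre minus its node is still connected ⟺ the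
vanishing cycle is nonseparating).  By Matsumoto/Endo such a fibration would have
`e = 6, σ = -6, b₁ = 2`; Xiao's and Matsumoto's genus-2 fibrations on `T² × S² # k CP²bar` have
`(n,s) = (4,3), (6,2)`; the statement is the `(10,0)` case of the genus-2 geography question. -/
def NoTenNodalGenusTwo : Prop :=
  ∀ (X : Type) [TopologicalSpace X] [T2Space X] [SecondCountableTopology X] [CompactSpace X]
    [ConnectedSpace X] [ChartedSpace (EuclideanSpace ℝ (Fin 4)) X]
    [IsManifold (𝓡 4) ((⊤ : ℕ∞) : WithTop ℕ∞) X]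
    (o : Literature.Topology.FourManifolds.SmoothOrientation (𝓡 4) X)
    (f : X → (Metric.sphere (0 : EuclideanSpace ℝ (Fin 3)) 1)) (L : Finset X),
    Literature.Topology.FourManifolds.IsAchiralLefschetzFibration (𝓡 4) (𝓡 2) o f L
        (fun _ => true) →
    L.card = 10 →
    (∀ y, (∀ q, f q = y → q ∉ L) → IsConnected (f ⁻¹' {y}) ∧
      Nonempty ((Fin 4 → ℤ) ≃ₗ[ℤ]
        Literature.AlgebraicTopology.SingularHomology.singularHomology ℤ ℤ ↥(f ⁻¹' {y}) 1)) →
    ∃ p ∈ L, ¬ IsPreconnected ((f ⁻¹' {f p}) \ {p})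

/-- The signature bookkeeping behind the pin (HS2 Thm 1.1 at genus 2, all four nodes of type I by
the spin constraint): writing the boundary monodromy as a word with `m` factors `t_c^{±1}`, `a`
factors `Δ_{c,β}^{±1}` (both of `h`-value `-2/5`), and `n₊`/`n₋` positive/negative twists along
nonseparating symmetric curves disjoint from `c` (`h`-value `-1/15`), `σ(X) = 0` reads
`6 (m + a) + (n₊ - n₋) = -36`. -/
theorem signature_pin_arith (m a np nm : ℤ)
    (h : -(3 : ℚ) / 5 * 4 + (-(2 : ℚ) / 5) * (m + a) + (-(1 : ℚ) / 15) * (np - nm) = 0) :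
    6 * (m + a) + (np - nm) = -36 := by
  have h' : (6 : ℚ) * (m + a) + (np - nm) = -36 := by linarith
  exact_mod_cast h'

end Summit.SmoothPoincare4.SmoothPoincare4.Cruxes.StepTwo.IdeateK2
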